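import Summits.BirchSwinnertonDyer.BirchSwinnertonDyer.Theorems.PrintCFramBottomClassIndexLawFiveLeSelmerDevissageLocalCriterionLevel
import Literature.NumberTheory.EllipticCurves.IsogenyDualProofs
import HarnessLib

/-!
# Route `PrintCFram`, crux C2 `BottomClassIndexLawFiveLe` (stmt-BirchSwinnertonDyer-20372), line
# `eisenstein-resource-bdp-line` (registry v19, stub B1 `stub_bsdp_of_classFactor`): **THE LOCAL KUMMER CRITERION, III —
# THE ISOGENY READING AND THE RANK-ONE SEE-SAW**
# (cell `bsd-print-cfram`, width seat `bsd-line-cfram-p1-w6` g4; helper `--supports` 20372; 0 defs, 0 facts, 0 sorry)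

HONEST FRAMING. Nothing about BSD is proved here and no stub is closed. Sequel of `…SelmerDevissageLocalCriterion(Level)`
(notation there: `v ∣ p`, `j : W(ℚ_v) → W(K̄_v)`, `ι = pointsMap`, `Φ ≤ W[p]` a stable subgroup; a `Φ`-ADAPTED `p`-th root
of a rational (local) point is a root whose Kummer cocycle on `Γ_v` is `Φ`-valued; (LT)(Φ) «every rational local point with
a `Φ`-adapted root is `p`-divisible in `W(ℚ_v)`»). The docstrings of those files read (LA)/(LT) as «`W(ℚ_p) = φ̂W'(ℚ_p) + pW(ℚ_p)`»
/ «`φ̂W'(ℚ_p) ⊆ pW(ℚ_p)`» for the isogeny `φ : W → W'` with kernel `Φ`; the tree's isogenies (`WeierstrassCurve.Isogeny`) act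
on `ℚ̄`-points only, so here that reading is made a kernel statement for RATIONAL points, which is what the line needs.

* §1 **`exists_adaptedRoot_of_eq_dual_apply`** — for `ℚ`-isogenies `φ : W → W'`, `ψ : W' → W` with `ψ ∘ φ = [p]` on
  `W(ℚ̄)` and `Φ ≤ W[p]` the kernel of `φ` on `W[p]` (`t ∈ Φ ↔ φ t = 0`, the shape delivered by w5 g3's
  `LevelDictionaryBeta.exists_kerLine_of_isogeny`): a rational point `P ∈ W(ℚ)` with `P = ψ(Q') + p S` in `W(ℚ̄)`
  (`Q' ∈ W'(ℚ)`, `S ∈ W(ℚ)`) has a `Φ`-adapted `p`-th root at EVERY finite place `v` (root `R₀ + S` with `φ R₀ = Q'`: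
  `φ` is onto `W'(ℚ̄)`, `Isogeny.surjective`; `σR₀ − R₀ ∈ ker φ ∩ W[p] = Φ`).
* §2 **`exists_toPadicPoint_eq_of_forall_imp_of_eq_dual_apply`** / **`toGeomPoints_ne_dual_apply_add_of_forall_imp_of_level_zero`** —
  with file B: on an (LT)-member at `p`, `P ∈ ψ(W'(ℚ)) + pW(ℚ)` forces the crux's LEVEL binder
  `∃ Q : W(ℚ_[p]), p • Q = toPadicPoint p P`; so a LEVEL-`0` rational point (the generator on the Kriz–Li locus, w6 g3
  `level_eq_zero_of_unit_classFactor`) is NOT of the form `ψ(Q') + pS`.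
* §3 THE RANK-ONE SEE-SAW (pure algebra of a dual pair on two rank-one groups): `A`, `A'` abelian groups with generators
  `g`, `g'` modulo torsion (`∀ R, ∃ k T, T torsion ∧ R = k • g + T`, `g` of infinite order), homomorphisms `f : A → A'`,
  `f' : A' → A` with `f' (f a) = p • a`, `p` prime: **`seeSaw_of_dual_pair`** — EXACTLY ONE of
  «`g = f' Q' + T` for some `Q'`, torsion `T`» / «`g' = f Q + T'`»; the integer bookkeeping `a b = p` for `f g ≡ a g'`,
  `f' g' ≡ b g` (`exists_int_mul_eq_prime_of_dual_pair`).
* §4 **`not_exists_eq_pointHom_add_torsion_of_level_zero`**, **`exists_partner_generator_eq_pointHom_add_torsion`** — §2 + §3 for the point homomorphisms of a dual pair of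
  degree-`p` `ℚ`-isogenies (`Isogeny.exists_pointHom` shape `toGeomPoints (f P) = φ (toGeomPoints P)`): on an (LT)-member at
  `p` whose generator `g` has LEVEL `0` and whose rational torsion is prime to `p`, the PARTNER's generator is `φ`-divisible:
  `g' = f Q + T'` — «on the Kriz–Li locus the transverse model's partner generator is `φ(g)` up to torsion and sign»; in
  index form `p ∤ [W'(ℚ) : φW(ℚ) + tors]`, `p ∣ [W(ℚ) : ψW'(ℚ) + tors]`.

THEOREMS ONLY; no definition, no named fact, no `sorry`. BSD is not proved by any of this; no summit statement is proved by
this seat. References: [SilvermanAEC2009] III.4 (Thm. 4.8, Cor. 4.9), III.6.1–6.2 (dual isogeny), VIII.§2, X.§4 (Rem. 4.7,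
Ex. 4.8: descent via a `p`-isogeny); seat notes w2g9 §3; LEAD g10 report §2(a)–(d).
-/

set_option autoImplicit false
-- `…BirchSwinnertonDyer.BirchSwinnertonDyer.Theorems…` is the problem's mandated namespace (D-0017).
set_option linter.dupNamespace false

noncomputable section

open scoped Classical

namespace Summit.BirchSwinnertonDyer.BirchSwinnertonDyer.Theorems.PrintCFram.SelmerCount

open NumberField IsDedekindDomain Field WeierstrassCurve
open Literature.NumberTheory.EllipticCurves Literature.NumberTheory.GaloisRepresentations
  Literature.NumberTheory.EllipticCurves.GreenbergSelmer
open Summit.BirchSwinnertonDyer.BirchSwinnertonDyer.Theorems.PrintCFram.LevelDictionary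
open Summit.BirchSwinnertonDyer.Rank1Residual.X2.ResidualDevissageModules

/-! ## §1 Global `φ̂`-divisibility gives `Φ`-adapted roots everywhere -/

section Isogeny

variable {W W' : WeierstrassCurve ℚ} [W.IsElliptic] [W'.IsElliptic] {p : ℕ} [hp : Fact p.Prime]

omit hp in
/-- **`P ∈ ψ(W'(ℚ)) + pW(ℚ)` ⟹ `P` has a `Φ`-adapted `p`-th root at every finite place.** Let `φ : W → W'`, `ψ : W' → W` be
`ℚ`-isogenies with `ψ (φ R) = p • R` on `W(ℚ̄)`, and `Φ ≤ W[p]` the kernel of `φ` on `W[p]` (`t ∈ Φ ↔ φ t = 0`). If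
`P ∈ W(ℚ)` satisfies `P = ψ(Q') + p • S` in `W(ℚ̄)` for rational `Q' ∈ W'(ℚ)`, `S ∈ W(ℚ)`, then at every finite place `v`
there is `R ∈ W(K̄_v)` with `p • R = ι P` and `σ • R − R ∈ ι(Φ)` for all `σ ∈ Γ_v`: take a preimage `R₀` of `Q'` under
`φ` (onto `W'(ℚ̄)`, Silverman II.2.3) and `R = ι(R₀ + S)`; `τR₀ − R₀` is killed by `φ` and by `p`.
[cite: SilvermanAEC2009, III.4 Thm. 4.8 and X.§4 Rem. 4.7] -/
theorem exists_adaptedRoot_of_eq_dual_apply (φ : Isogeny W W') (ψ : Isogeny W' W)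
    (hdual : ∀ R : geomPoints W, ψ (φ R) = (p : ℤ) • R)
    (Φ : StableSubgroup (absoluteGaloisGroup ℚ) (geomTorsion W (p : ℤ)))
    (hker : ∀ t : geomTorsion W (p : ℤ), t ∈ Φ.toAddSubgroup ↔ φ (t : geomPoints W) = 0)
    (P S : W.toAffine.Point) (Q' : W'.toAffine.Point)
    (hP : toGeomPoints W P = ψ (toGeomPoints W' Q') + (p : ℤ) • toGeomPoints W S) (v : HeightOneSpectrum (𝓞 ℚ)) :
    ∃ R : localPoints W (v.adicCompletion ℚ),
      (p : ℤ) • R = pointsMap W (v.adicCompletion ℚ) (toGeomPoints W P) ∧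
      ∀ σ : absoluteGaloisGroup (v.adicCompletion ℚ), ∃ t ∈ Φ.toAddSubgroup,
        σ • R - R = pointsMap W (v.adicCompletion ℚ) (t : geomPoints W) := by
  obtain ⟨R₀, hR₀⟩ := φ.surjective (toGeomPoints W' Q')
  -- the global Kummer cocycle of `R₀` is `Φ`-valued
  have htors : ∀ τ : absoluteGaloisGroup ℚ, (p : ℤ) • (τ • R₀ - R₀) = 0 := fun τ ↦ by
    rw [zsmul_sub, smul_comm, ← hdual R₀, hR₀, ← ψ.map_smul, smul_toGeomPoints, sub_self]
  have hkerτ : ∀ τ : absoluteGaloisGroup ℚ, φ (τ • R₀ - R₀) = 0 := fun τ ↦ by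
    rw [map_sub, φ.map_smul, hR₀, smul_toGeomPoints, sub_self]
  refine ⟨pointsMap W (v.adicCompletion ℚ) (R₀ + toGeomPoints W S), ?_, fun σ ↦ ?_⟩
  · rw [← map_zsmul, zsmul_add, ← hdual R₀, hR₀, ← hP]
  · refine ⟨⟨resGal (K := ℚ) (v.adicCompletion ℚ) σ • R₀ - R₀, (mem_geomTorsion_iff W (p : ℤ) _).mpr (htors _)⟩,
      (hker _).mpr (hkerτ _), ?_⟩
    rw [← pointsMap_smul, ← map_sub, smul_add, smul_toGeomPoints]
    congr 1
    abel

/-- **On an (LT)-member, `P ∈ ψ(W'(ℚ)) + pW(ℚ)` forces LEVEL ≥ 1** (the crux's binder `∃ Q : W(ℚ_[p]), p • Q = toPadicPoint p P`):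
§1 with file B's `exists_toPadicPoint_eq_of_forall_imp_of_adaptedRoot`. [cite: SilvermanAEC2009, X.§4 (Rem. 4.7, Ex. 4.8)] -/
theorem exists_toPadicPoint_eq_of_forall_imp_of_eq_dual_apply (φ : Isogeny W W') (ψ : Isogeny W' W)
    (hdual : ∀ R : geomPoints W, ψ (φ R) = (p : ℤ) • R)
    (Φ : StableSubgroup (absoluteGaloisGroup ℚ) (geomTorsion W (p : ℤ)))
    (hker : ∀ t : geomTorsion W (p : ℤ), t ∈ Φ.toAddSubgroup ↔ φ (t : geomPoints W) = 0)
    {v : HeightOneSpectrum (𝓞 ℚ)} (hpv : ((p : ℕ) : 𝓞 ℚ) ∈ v.asIdeal)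
    (hLT : ∀ P : (W.baseChange (v.adicCompletion ℚ)).toAffine.Point,
      (∃ R : localPoints W (v.adicCompletion ℚ),
        (p : ℤ) • R = Affine.Point.map (W' := W)
          (IsScalarTower.toAlgHom ℚ (v.adicCompletion ℚ) (AlgebraicClosure (v.adicCompletion ℚ))) P ∧
        ∀ σ : absoluteGaloisGroup (v.adicCompletion ℚ), ∃ t ∈ Φ.toAddSubgroup,
          σ • R - R = pointsMap W (v.adicCompletion ℚ) (t : geomPoints W)) →
      ∃ S : (W.baseChange (v.adicCompletion ℚ)).toAffine.Point, p • S = P)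
    (P S : W.toAffine.Point) (Q' : W'.toAffine.Point)
    (hP : toGeomPoints W P = ψ (toGeomPoints W' Q') + (p : ℤ) • toGeomPoints W S) :
    ∃ Q : (W.baseChange ℚ_[p]).toAffine.Point, p • Q = W.toPadicPoint p P :=
  exists_toPadicPoint_eq_of_forall_imp_of_adaptedRoot W v Φ hpv hLT P
    (exists_adaptedRoot_of_eq_dual_apply φ ψ hdual Φ hker P S Q' hP v)

/-- **On an (LT)-member, a LEVEL-`0` rational point is NOT in `ψ(W'(ℚ)) + pW(ℚ)`** (contrapositive of the previous theorem;
LEVEL `0` = `∀ Q, p • Q ≠ toPadicPoint p P`, the Kriz–Li locus' shape), stated in `W(ℚ̄)`: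
`ι P ≠ ψ(ι Q') + p • ι S` for all rational `Q'`, `S`. [cite: SilvermanAEC2009, X.§4 (Rem. 4.7, Ex. 4.8)] -/
theorem toGeomPoints_ne_dual_apply_add_of_forall_imp_of_level_zero (φ : Isogeny W W') (ψ : Isogeny W' W)
    (hdual : ∀ R : geomPoints W, ψ (φ R) = (p : ℤ) • R)
    (Φ : StableSubgroup (absoluteGaloisGroup ℚ) (geomTorsion W (p : ℤ)))
    (hker : ∀ t : geomTorsion W (p : ℤ), t ∈ Φ.toAddSubgroup ↔ φ (t : geomPoints W) = 0)
    {v : HeightOneSpectrum (𝓞 ℚ)} (hpv : ((p : ℕ) : 𝓞 ℚ) ∈ v.asIdeal)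
    (hLT : ∀ P : (W.baseChange (v.adicCompletion ℚ)).toAffine.Point,
      (∃ R : localPoints W (v.adicCompletion ℚ),
        (p : ℤ) • R = Affine.Point.map (W' := W)
          (IsScalarTower.toAlgHom ℚ (v.adicCompletion ℚ) (AlgebraicClosure (v.adicCompletion ℚ))) P ∧
        ∀ σ : absoluteGaloisGroup (v.adicCompletion ℚ), ∃ t ∈ Φ.toAddSubgroup,
          σ • R - R = pointsMap W (v.adicCompletion ℚ) (t : geomPoints W)) →
      ∃ S : (W.baseChange (v.adicCompletion ℚ)).toAffine.Point, p • S = P)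
    (P : W.toAffine.Point) (hlev : ∀ Q : (W.baseChange ℚ_[p]).toAffine.Point, p • Q ≠ W.toPadicPoint p P)
    (Q' : W'.toAffine.Point) (S : W.toAffine.Point) :
    toGeomPoints W P ≠ ψ (toGeomPoints W' Q') + (p : ℤ) • toGeomPoints W S := by
  intro hP
  obtain ⟨Q, hQ⟩ := exists_toPadicPoint_eq_of_forall_imp_of_eq_dual_apply φ ψ hdual Φ hker hpv hLT P S Q' hP
  exact hlev Q hQ

end Isogeny

/-! ## §3 The rank-one see-saw of a dual pair (pure algebra) -/

section SeeSaw

variable {A A' : Type} [AddCommGroup A] [AddCommGroup A'] {p : ℕ} [hp : Fact p.Prime]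

omit hp in
/-- `n • g` of finite order with `n ≠ 0` forces `g` of finite order (`IsOfFinAddOrder.of_nsmul` for integers). [folklore] -/
theorem isOfFinAddOrder_of_zsmul {g : A} {n : ℤ} (h : IsOfFinAddOrder (n • g)) (hn : n ≠ 0) : IsOfFinAddOrder g := by
  have h' : IsOfFinAddOrder (n.natAbs • g) := by
    rcases Int.natAbs_eq n with he | he
    · rw [← natCast_zsmul, ← he]; exact h
    · rw [← natCast_zsmul, ← isOfFinAddOrder_neg_iff, ← neg_zsmul, ← he]; exact h
  exact h'.of_nsmul (Int.natAbs_ne_zero.mpr hn)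

omit hp in
/-- **The integer bookkeeping of a dual pair on rank-one groups.** `f : A → A'`, `f' : A' → A` with `f' (f a) = p • a`; `g` of
infinite order; if `f g = a • g' + T'` and `f' g' = b • g + T` with `T`, `T'` torsion then `a * b = p`.
[cite: SilvermanAEC2009, III.6.2 and X.§4 Rem. 4.7] -/
theorem int_mul_eq_prime_of_dual_pair (f : A →+ A') (f' : A' →+ A) (hff' : ∀ a, f' (f a) = p • a)
    {g : A} (hg : ¬ IsOfFinAddOrder g) {g' : A'} {a b : ℤ} {T' : A'} (hT' : IsOfFinAddOrder T')
    (ha : f g = a • g' + T') {T : A} (hT : IsOfFinAddOrder T) (hb : f' g' = b • g + T) : a * b = p := by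
  -- `p • g = f'(f g) = (a*b) • g + (a • T + f' T')`
  have h1 : ((p : ℤ) - a * b) • g = a • T + f' T' := by
    have h := hff' g
    rw [ha, map_add, map_zsmul, hb, zsmul_add, ← mul_zsmul, ← natCast_zsmul] at h
    rw [sub_zsmul, ← h]
    abel
  have hfin : IsOfFinAddOrder (((p : ℤ) - a * b) • g) := by
    rw [h1]
    exact (hT.zsmul (i := a)).add (f'.isOfFinAddOrder hT')
  by_contra hab
  exact hg (isOfFinAddOrder_of_zsmul hfin (sub_ne_zero.mpr (Ne.symm hab)))

/-- **`g ∈ f'(A') + A_tors` iff the integer `b` of `f' g' ≡ b • g` is a unit** (generators modulo torsion on both sides).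
[cite: SilvermanAEC2009, X.§4 Rem. 4.7] -/
theorem exists_eq_apply_add_torsion_iff_isUnit (f' : A' →+ A)
    {g : A} (hg : ¬ IsOfFinAddOrder g) {g' : A'}
    (hgen' : ∀ R : A', ∃ (k : ℤ) (T : A'), IsOfFinAddOrder T ∧ R = k • g' + T)
    {b : ℤ} {T : A} (hT : IsOfFinAddOrder T) (hb : f' g' = b • g + T) :
    (∃ (Q' : A') (T₁ : A), IsOfFinAddOrder T₁ ∧ g = f' Q' + T₁) ↔ IsUnit b := by
  constructor
  · rintro ⟨Q', T₁, hT₁, hgQ⟩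
    obtain ⟨k, T₂, hT₂, hQ'⟩ := hgen' Q'
    have e : f' Q' = (k * b) • g + (k • T + f' T₂) := by
      rw [hQ', map_add, map_zsmul, hb, zsmul_add, ← mul_zsmul]; abel
    have e1 : T₁ = g - f' Q' := by rw [hgQ]; abel
    have h2 : (1 - k * b) • g = k • T + f' T₂ + T₁ := by
      rw [e1, e, sub_zsmul, one_zsmul]; abel
    have hfin : IsOfFinAddOrder ((1 - k * b) • g) := by
      rw [h2]; exact ((hT.zsmul (i := k)).add (f'.isOfFinAddOrder hT₂)).add hT₁
    have hkb : 1 - k * b = 0 := by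
      by_contra hne
      exact hg (isOfFinAddOrder_of_zsmul hfin hne)
    exact IsUnit.of_mul_eq_one_right k (by linarith)
  · rintro ⟨u, rfl⟩
    refine ⟨((u⁻¹ : ℤˣ) : ℤ) • g', -(((u⁻¹ : ℤˣ) : ℤ) • T), (hT.zsmul (i := ((u⁻¹ : ℤˣ) : ℤ))).neg, ?_⟩
    rw [map_zsmul, hb, zsmul_add, ← mul_zsmul, Units.inv_mul, one_zsmul]
    abel

/-- **THE RANK-ONE SEE-SAW.** For a dual pair `f : A → A'`, `f' : A' → A` (`f' ∘ f = p`, `p` prime) of groups with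
generators `g`, `g'` modulo torsion, both of infinite order: EXACTLY ONE of «`g ∈ f'(A') + A_tors`», «`g' ∈ f(A) + A'_tors`» holds
(the integers `a`, `b` with `f g ≡ a • g'`, `f' g' ≡ b • g` satisfy `a b = p`, so exactly one of them is a unit).
[cite: SilvermanAEC2009, III.6.2 and X.§4 Rem. 4.7] -/
theorem seeSaw_of_dual_pair (f : A →+ A') (f' : A' →+ A) (hff' : ∀ a, f' (f a) = p • a)
    {g : A} (hg : ¬ IsOfFinAddOrder g) (hgen : ∀ R : A, ∃ (k : ℤ) (T : A), IsOfFinAddOrder T ∧ R = k • g + T)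
    {g' : A'} (hg' : ¬ IsOfFinAddOrder g') (hgen' : ∀ R : A', ∃ (k : ℤ) (T : A'), IsOfFinAddOrder T ∧ R = k • g' + T) :
    ((∃ (Q' : A') (T : A), IsOfFinAddOrder T ∧ g = f' Q' + T) ∨
      ∃ (Q : A) (T' : A'), IsOfFinAddOrder T' ∧ g' = f Q + T') ∧
    ¬ ((∃ (Q' : A') (T : A), IsOfFinAddOrder T ∧ g = f' Q' + T) ∧
      ∃ (Q : A) (T' : A'), IsOfFinAddOrder T' ∧ g' = f Q + T') := by
  obtain ⟨a, T', hT', ha⟩ := hgen' (f g)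
  obtain ⟨b, T, hT, hb⟩ := hgen (f' g')
  have hab : a * b = p := int_mul_eq_prime_of_dual_pair f f' hff' hg hT' ha hT hb
  rw [exists_eq_apply_add_torsion_iff_isUnit f' hg hgen' hT hb, exists_eq_apply_add_torsion_iff_isUnit f hg' hgen hT' ha]
  have hpr : Prime (p : ℤ) := Nat.prime_iff_prime_int.mp hp.out
  refine ⟨(hpr.irreducible.isUnit_or_isUnit hab.symm).symm, fun h ↦ hpr.not_unit ?_⟩
  rw [← hab]
  exact h.2.mul h.1

end SeeSaw

/-! ## §4 The partner's generator on a transverse regular member -/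

section Partner

variable {W W' : WeierstrassCurve ℚ} [W.IsElliptic] [W'.IsElliptic] {p : ℕ} [hp : Fact p.Prime]

omit [W.IsElliptic] hp in
/-- `ι (P + Q) = ι P + ι Q` for `W(ℚ) → W(ℚ̄)` (the tree's `toGeomPoints` is additive; recorded across the two `DecidableEq ℚ`
instances that occur for `ℚ`-points — Mathlib's `instDecidableEqRat` here, the classical one inside the generic-`K` definition).
[folklore] -/
theorem toGeomPoints_add_rat (P Q : W.toAffine.Point) : toGeomPoints W (P + Q) = toGeomPoints W P + toGeomPoints W Q := by
  convert @AddMonoidHom.map_add _ _ (_) (_) (toGeomPoints W) P Q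
  exact congrArg (fun d : DecidableEq ℚ ↦ @Affine.Point.instAdd ℚ _ W.toAffine d) (Subsingleton.elim _ _)

omit [W.IsElliptic] hp in
/-- `ι (n • P) = n • ι P` for `W(ℚ) → W(ℚ̄)` (same remark). [folklore] -/
theorem toGeomPoints_nsmul_rat (n : ℕ) (P : W.toAffine.Point) : toGeomPoints W (n • P) = n • toGeomPoints W P := by
  induction n with
  | zero =>
    rw [zero_nsmul, zero_nsmul]
    exact @AddMonoidHom.map_zero _ _ (_) (_) (toGeomPoints W)
  | succ n ih => rw [succ_nsmul, succ_nsmul, toGeomPoints_add_rat, ih]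

/-- **On a transverse member with a LEVEL-`0` generator, the generator is not `ψ`-divisible modulo torsion.** Setting of §1–§2
(`φ`, `ψ` dual of degree `p`, `Φ = ker φ|_{W[p]}`, (LT) at `v ∣ p`, `g ∈ W(ℚ)` of LEVEL `0`); `f' : W'(ℚ) → W(ℚ)` the map of `ψ`
on rational points (`ι (f' Q') = ψ (ι Q')`, `Isogeny.exists_pointHom`); assume the rational torsion of `W` is `p`-divisible
(`T` torsion ⟹ `T = p • T₁`; automatic when `#W(ℚ)_tors` is prime to `p`, as on the CM-ramified class). Then
`g ≠ f' Q' + T` for every `Q' ∈ W'(ℚ)` and torsion `T`. [cite: SilvermanAEC2009, X.§4 (Rem. 4.7, Ex. 4.8)] -/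
theorem not_exists_eq_pointHom_add_torsion_of_level_zero (φ : Isogeny W W') (ψ : Isogeny W' W)
    (hdual : ∀ R : geomPoints W, ψ (φ R) = (p : ℤ) • R)
    (f' : W'.toAffine.Point →+ W.toAffine.Point) (hf' : ∀ Q', toGeomPoints W (f' Q') = ψ (toGeomPoints W' Q'))
    (Φ : StableSubgroup (absoluteGaloisGroup ℚ) (geomTorsion W (p : ℤ)))
    (hker : ∀ t : geomTorsion W (p : ℤ), t ∈ Φ.toAddSubgroup ↔ φ (t : geomPoints W) = 0)
    {v : HeightOneSpectrum (𝓞 ℚ)} (hpv : ((p : ℕ) : 𝓞 ℚ) ∈ v.asIdeal)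
    (hLT : ∀ P : (W.baseChange (v.adicCompletion ℚ)).toAffine.Point,
      (∃ R : localPoints W (v.adicCompletion ℚ),
        (p : ℤ) • R = Affine.Point.map (W' := W)
          (IsScalarTower.toAlgHom ℚ (v.adicCompletion ℚ) (AlgebraicClosure (v.adicCompletion ℚ))) P ∧
        ∀ σ : absoluteGaloisGroup (v.adicCompletion ℚ), ∃ t ∈ Φ.toAddSubgroup,
          σ • R - R = pointsMap W (v.adicCompletion ℚ) (t : geomPoints W)) →
      ∃ S : (W.baseChange (v.adicCompletion ℚ)).toAffine.Point, p • S = P)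
    (htor : ∀ T : W.toAffine.Point, IsOfFinAddOrder T → ∃ T₁ : W.toAffine.Point, T = p • T₁)
    (g : W.toAffine.Point) (hlev : ∀ Q : (W.baseChange ℚ_[p]).toAffine.Point, p • Q ≠ W.toPadicPoint p g) :
    ¬ ∃ (Q' : W'.toAffine.Point) (T : W.toAffine.Point), IsOfFinAddOrder T ∧ g = f' Q' + T := by
  rintro ⟨Q', T, hT, hg⟩
  obtain ⟨T₁, rfl⟩ := htor T hT
  refine toGeomPoints_ne_dual_apply_add_of_forall_imp_of_level_zero φ ψ hdual Φ hker hpv hLT g hlev Q' T₁ ?_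
  rw [hg, toGeomPoints_add_rat, hf', toGeomPoints_nsmul_rat, natCast_zsmul]

/-- **THE PARTNER'S GENERATOR IS `φ`-DIVISIBLE on a transverse member with a LEVEL-`0` generator** (§3's see-saw + the previous
theorem). `f : W(ℚ) → W'(ℚ)`, `f' : W'(ℚ) → W(ℚ)` the maps on rational points of the dual pair (`f' (f P) = p • P`,
`ι (f' Q') = ψ (ι Q')`), `g`, `g'` generators modulo torsion of `W(ℚ)`, `W'(ℚ)` of infinite order, torsion of
`W(ℚ)` `p`-divisible, `W` an (LT)-member at `v ∣ p` along `Φ = ker φ|_{W[p]}` whose generator has LEVEL `0` (the Kriz–Li locus'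
shape on the transverse model): then `g' = f Q + T'` with `T'` torsion — i.e. `p ∤ [W'(ℚ) : φW(ℚ) + tors]` while
`p ∣ [W(ℚ) : ψW'(ℚ) + tors]`. [cite: SilvermanAEC2009, III.6.2 and X.§4 (Rem. 4.7, Ex. 4.8)] -/
theorem exists_partner_generator_eq_pointHom_add_torsion (φ : Isogeny W W') (ψ : Isogeny W' W)
    (hdual : ∀ R : geomPoints W, ψ (φ R) = (p : ℤ) • R)
    (f : W.toAffine.Point →+ W'.toAffine.Point) (f' : W'.toAffine.Point →+ W.toAffine.Point)
    (hff' : ∀ P, f' (f P) = p • P)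
    (hf' : ∀ Q', toGeomPoints W (f' Q') = ψ (toGeomPoints W' Q'))
    (Φ : StableSubgroup (absoluteGaloisGroup ℚ) (geomTorsion W (p : ℤ)))
    (hker : ∀ t : geomTorsion W (p : ℤ), t ∈ Φ.toAddSubgroup ↔ φ (t : geomPoints W) = 0)
    {v : HeightOneSpectrum (𝓞 ℚ)} (hpv : ((p : ℕ) : 𝓞 ℚ) ∈ v.asIdeal)
    (hLT : ∀ P : (W.baseChange (v.adicCompletion ℚ)).toAffine.Point,
      (∃ R : localPoints W (v.adicCompletion ℚ),
        (p : ℤ) • R = Affine.Point.map (W' := W)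
          (IsScalarTower.toAlgHom ℚ (v.adicCompletion ℚ) (AlgebraicClosure (v.adicCompletion ℚ))) P ∧
        ∀ σ : absoluteGaloisGroup (v.adicCompletion ℚ), ∃ t ∈ Φ.toAddSubgroup,
          σ • R - R = pointsMap W (v.adicCompletion ℚ) (t : geomPoints W)) →
      ∃ S : (W.baseChange (v.adicCompletion ℚ)).toAffine.Point, p • S = P)
    (htor : ∀ T : W.toAffine.Point, IsOfFinAddOrder T → ∃ T₁ : W.toAffine.Point, T = p • T₁)
    {g : W.toAffine.Point} (hg : ¬ IsOfFinAddOrder g)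
    (hgen : ∀ R : W.toAffine.Point, ∃ (k : ℤ) (T : W.toAffine.Point), IsOfFinAddOrder T ∧ R = k • g + T)
    (hlev : ∀ Q : (W.baseChange ℚ_[p]).toAffine.Point, p • Q ≠ W.toPadicPoint p g)
    {g' : W'.toAffine.Point} (hg' : ¬ IsOfFinAddOrder g')
    (hgen' : ∀ R : W'.toAffine.Point, ∃ (k : ℤ) (T : W'.toAffine.Point), IsOfFinAddOrder T ∧ R = k • g' + T) :
    ∃ (Q : W.toAffine.Point) (T' : W'.toAffine.Point), IsOfFinAddOrder T' ∧ g' = f Q + T' :=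
  ((seeSaw_of_dual_pair f f' hff' hg hgen hg' hgen').1).resolve_left
    (not_exists_eq_pointHom_add_torsion_of_level_zero φ ψ hdual f' hf' Φ hker hpv hLT htor g hlev)

end Partner


end Summit.BirchSwinnertonDyer.BirchSwinnertonDyer.Theorems.PrintCFram.SelmerCount

end
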